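import Summits.Ventures.HodgeRepro2.T5FinitePlaceTensorClassification

/-!
# Row N2.2.2 at EVERY finite place of `K⁺`, on the route's local algebra, from the datum `(θ, y)` alone
(cell pub-hodge-repro2, seat p3)

Tier-5 N2 support, rows N2.2.2 / N2.8.1 of route/T5-N2-route-3.md — the capstone of the local column. The CM field
`K` with `K⁺ = maximalRealSubfield K`, `c = complexConj K`, and the datum of files 120–126: `θ ∈ K⁺`, `y ∈ K` with
`θ = y²` and `c y ≠ y` (so `K = K⁺(y)`, `c y = −y`). For a finite place `v` of `K⁺` and a place `w` of `K` above
it, on the route's local algebra `K⁺_v ⊗_{K⁺} K` with the conjugation `1 ⊗ c` (file 146's `tensorStarRing`):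

* `exists_conj_place`: at a SPLIT place (`θ` a `v`-adic square) `c` moves `w` to a second place `w' ≠ w` above
  `v` (`c • w = w'`; file 125's `complexConj_smul_ne_of_isSquare`, Mathlib's `Ideal.IsPrime.smul`; it lies over `v`
  because `c` fixes `K⁺`);
* `isCongruent_of_isSquare`: at a split place any two invertible hermitian matrices are congruent (file 146);
* `isCongruent_iff_exists_det_eq_of_not_isSquare` / `isCongruent_iff_hilbertSolvable_of_not_isSquare` /
  `exists_two_classes_of_not_isSquare`: at a NON-SPLIT place Shimura's Lemma 1.6, row N2.8.1 (i)'s Hilbert-symbol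
  criterion and HKS96's «precisely two classes» (file 151), with `hspan` and `c y = −y` supplied by file 120;
* **`classification`**: the two cases in ONE statement — for every finite place `v` of `K⁺`: if `θ` is a `v`-adic
  square, congruent; if not, congruent iff the determinants differ by a norm `star u · u`.

No printed input anywhere in the cone of these statements beyond Mathlib. Mathlib + this seat's files 115–151
and seat p4's chain through them only; no display; no device. §8(d): uses an L-value-free non-vanishing device: NO.
-/

namespace Summit.Ventures.HodgeRepro2.T5FinitePlaceClassification

open IsDedekindDomain IsDedekindDomain.HeightOneSpectrum NumberField NumberField.IsCMField Module Matrix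
open scoped TensorProduct Pointwise
open Summit.Ventures.HodgeRepro2.T5FinitePlaceCM Summit.Ventures.HodgeRepro2.T5FinitePlaceCMDecomp
  Summit.Ventures.HodgeRepro2.T5FinitePlaceSplitClassification Summit.Ventures.HodgeRepro2.T5HermitianDetClass
  Summit.Ventures.HodgeRepro2.T5HermitianClassify Summit.Ventures.HodgeRepro2.T5HilbertSymbolNorm
  Summit.Ventures.HodgeRepro2.T5FinitePlaceTensorClassification

section Place

variable (K : Type*) [Field K] [NumberField K] [IsCMField K]
variable {θ : maximalRealSubfield K} {y : K}
  (hθ : algebraMap (maximalRealSubfield K) K θ = y ^ 2) (hy : complexConj K y ≠ y)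
variable (v : HeightOneSpectrum (𝓞 (maximalRealSubfield K))) (w : HeightOneSpectrum (𝓞 K))
  [w.asIdeal.LiesOver v.asIdeal]

include hθ hy in
/-- **The conjugate place:** at a split place (`θ` a `v`-adic square) the conjugation `c` moves `w` to a second
place `w' ≠ w` of `K` above `v`, `c • w = w'`. -/
theorem exists_conj_place
    (hsq : IsSquare (algebraMap (maximalRealSubfield K) (v.adicCompletion (maximalRealSubfield K)) θ)) :
    ∃ w' : HeightOneSpectrum (𝓞 K), ∃ _ : w'.asIdeal.LiesOver v.asIdeal,
      complexConj K • w.asIdeal = w'.asIdeal ∧ w ≠ w' := by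
  have hne : complexConj K • w.asIdeal ≠ w.asIdeal := complexConj_smul_ne_of_isSquare K hθ hy v w hsq
  have hinj : Function.Injective
      (MulSemiringAction.toRingHom (K ≃ₐ[maximalRealSubfield K] K) (𝓞 K) (complexConj K)) :=
    fun a b h => MulAction.injective (complexConj K) h
  have hbot : complexConj K • w.asIdeal ≠ ⊥ := by
    rw [Ideal.pointwise_smul_def, Ne, Ideal.map_eq_bot_iff_of_injective hinj]
    exact w.ne_bot
  -- `c` fixes `K⁺`, so `c⁻¹ • w` lies over `v` as `w` does
  have hfix : ∀ a : 𝓞 (maximalRealSubfield K),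
      (complexConj K)⁻¹ • algebraMap (𝓞 (maximalRealSubfield K)) (𝓞 K) a =
        algebraMap (𝓞 (maximalRealSubfield K)) (𝓞 K) a := by
    intro a
    apply Subtype.ext
    exact AlgEquiv.commutes (complexConj K)⁻¹ (a : maximalRealSubfield K)
  have hLO : (complexConj K • w.asIdeal).LiesOver v.asIdeal := by
    refine ⟨?_⟩
    ext a
    rw [Ideal.mem_under, Ideal.mem_pointwise_smul_iff_inv_smul_mem, hfix a, ← Ideal.mem_under,
      ← Ideal.LiesOver.over (P := w.asIdeal) (p := v.asIdeal)]
  exact ⟨⟨complexConj K • w.asIdeal, Ideal.IsPrime.smul _, hbot⟩, hLO, rfl,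
    fun h => hne (congrArg HeightOneSpectrum.asIdeal h).symm⟩

include hθ hy w in
/-- **Row N2.2.2 at a SPLIT place, from the datum alone:** any two invertible hermitian matrices over `K⁺_v ⊗ K`
(conjugation `1 ⊗ c`) are congruent when `θ` is a `v`-adic square. -/
theorem isCongruent_of_isSquare
    (hsq : IsSquare (algebraMap (maximalRealSubfield K) (v.adicCompletion (maximalRealSubfield K)) θ))
    {n : Type*} [Fintype n] [DecidableEq n]
    {H H' : Matrix n n ((v.adicCompletion (maximalRealSubfield K)) ⊗[maximalRealSubfield K] K)}
    (hH : letI := tensorStarRing K v; H.IsHermitian) (hH' : letI := tensorStarRing K v; H'.IsHermitian)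
    (hdet : IsUnit H.det) (hdet' : IsUnit H'.det) :
    letI := tensorStarRing K v
    IsCongruent H H' := by
  letI := tensorStarRing K v
  obtain ⟨w', hLO, hw, hne⟩ := exists_conj_place K hθ hy v w hsq
  exact isCongruent_of_isHermitian K v w w' hw hθ hy hne hsq hH hH' hdet hdet'

include hθ hy w in
/-- **Row N2.2.2 at a NON-SPLIT place, from the datum alone** (Shimura's Lemma 1.6 on `K⁺_v ⊗ K`): when `θ` is not
a `v`-adic square, two invertible hermitian matrices are congruent iff their determinants differ by a norm. -/
theorem isCongruent_iff_exists_det_eq_of_not_isSquare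
    (hsq : ¬ IsSquare (algebraMap (maximalRealSubfield K) (v.adicCompletion (maximalRealSubfield K)) θ))
    {n : Type*} [Fintype n] [DecidableEq n]
    {H H' : Matrix n n ((v.adicCompletion (maximalRealSubfield K)) ⊗[maximalRealSubfield K] K)}
    (hH : letI := tensorStarRing K v; H.IsHermitian) (hH' : letI := tensorStarRing K v; H'.IsHermitian)
    (hdet : IsUnit H.det) :
    letI := tensorStarRing K v
    IsCongruent H H' ↔ ∃ u : (v.adicCompletion (maximalRealSubfield K)) ⊗[maximalRealSubfield K] K,
      u ≠ 0 ∧ H'.det = star u * u * H.det :=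
  isCongruent_iff_exists_det_eq_tensor K v w hθ.symm (span_pair_eq_top K hy) hsq
    (complexConj_apply_eq_neg K hθ hy) hH hH' hdet

include hθ hy w in
/-- **Row N2.8.1 (i) at a NON-SPLIT place, from the datum alone:** Gram matrices with `det H' = (a ⊗ 1) · det H`
are congruent iff `(a, θ)_v = 1`. -/
theorem isCongruent_iff_hilbertSolvable_of_not_isSquare
    (hsq : ¬ IsSquare (algebraMap (maximalRealSubfield K) (v.adicCompletion (maximalRealSubfield K)) θ))
    {n : Type*} [Fintype n] [DecidableEq n]
    {H H' : Matrix n n ((v.adicCompletion (maximalRealSubfield K)) ⊗[maximalRealSubfield K] K)}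
    (hH : letI := tensorStarRing K v; H.IsHermitian) (hH' : letI := tensorStarRing K v; H'.IsHermitian)
    (hdet : IsUnit H.det) {a : v.adicCompletion (maximalRealSubfield K)} (ha : a ≠ 0)
    (hdet' : H'.det = algebraMap (v.adicCompletion (maximalRealSubfield K))
      ((v.adicCompletion (maximalRealSubfield K)) ⊗[maximalRealSubfield K] K) a * H.det) :
    letI := tensorStarRing K v
    IsCongruent H H' ↔
      HilbertSolvable a (algebraMap (maximalRealSubfield K) (v.adicCompletion (maximalRealSubfield K)) θ) :=
  isCongruent_iff_hilbertSolvable_tensor K v w hθ.symm (span_pair_eq_top K hy) hsq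
    (complexConj_apply_eq_neg K hθ hy) hH hH' hdet ha hdet'

include hθ hy w in
/-- **HKS96's «precisely two classes in each dimension» at a NON-SPLIT place, from the datum alone.** -/
theorem exists_two_classes_of_not_isSquare
    (hsq : ¬ IsSquare (algebraMap (maximalRealSubfield K) (v.adicCompletion (maximalRealSubfield K)) θ))
    (m : ℕ) :
    letI := tensorStarRing K v
    ∃ H₁ H₂ : Matrix (Fin (m + 1)) (Fin (m + 1))
        ((v.adicCompletion (maximalRealSubfield K)) ⊗[maximalRealSubfield K] K),
      H₁.IsHermitian ∧ H₂.IsHermitian ∧ IsUnit H₁.det ∧ IsUnit H₂.det ∧ ¬ IsCongruent H₁ H₂ ∧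
        ∀ H : Matrix (Fin (m + 1)) (Fin (m + 1))
          ((v.adicCompletion (maximalRealSubfield K)) ⊗[maximalRealSubfield K] K),
          H.IsHermitian → IsUnit H.det → IsCongruent H H₁ ∨ IsCongruent H H₂ :=
  exists_two_classes_tensor K v w hθ.symm (span_pair_eq_top K hy) hsq (complexConj_apply_eq_neg K hθ hy) m

include hθ hy w in
/-- **ROW N2.2.2 AT EVERY FINITE PLACE OF `K⁺`, on the route's local algebra `K⁺_v ⊗ K` with the conjugation
`1 ⊗ c`, from the datum `(θ, y)` alone:** if `θ` is a `v`-adic square (the place splits) any two invertible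
hermitian matrices are congruent; if not (the place is inert or ramified, dyadic or not) they are congruent iff
their determinants differ by a norm `star u · u`. No printed input. -/
theorem classification {n : Type*} [Fintype n] [DecidableEq n]
    {H H' : Matrix n n ((v.adicCompletion (maximalRealSubfield K)) ⊗[maximalRealSubfield K] K)}
    (hH : letI := tensorStarRing K v; H.IsHermitian) (hH' : letI := tensorStarRing K v; H'.IsHermitian)
    (hdet : IsUnit H.det) (hdet' : IsUnit H'.det) :
    letI := tensorStarRing K v
    (IsSquare (algebraMap (maximalRealSubfield K) (v.adicCompletion (maximalRealSubfield K)) θ) →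
        IsCongruent H H') ∧
      (¬ IsSquare (algebraMap (maximalRealSubfield K) (v.adicCompletion (maximalRealSubfield K)) θ) →
        (IsCongruent H H' ↔ ∃ u : (v.adicCompletion (maximalRealSubfield K)) ⊗[maximalRealSubfield K] K,
          u ≠ 0 ∧ H'.det = star u * u * H.det)) :=
  ⟨fun hsq => isCongruent_of_isSquare K hθ hy v w hsq hH hH' hdet hdet',
    fun hsq => isCongruent_iff_exists_det_eq_of_not_isSquare K hθ hy v w hsq hH hH' hdet⟩

end Place

end Summit.Ventures.HodgeRepro2.T5FinitePlaceClassification
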